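import Literature.AlgebraicGeometry.ModuliOfAbelianVarieties.SiegelMarkingTowerFrames
import Literature.AlgebraicGeometry.AbelianSchemes.LevelStructureOfTorsionBasis
import HarnessLib

/-!
# The level-`N` structure of a marked complex abelian variety (`η_a = u ∘ a` on `N`-division points)

Topic `AlgebraicGeometry/ModuliOfAbelianVarieties`; namespace
`Literature.AlgebraicGeometry.ModuliOfAbelianVarieties.SiegelAdelicMarking`; THEOREMS ONLY (no definition, no
named fact, no instance).  For a marking `m` of a complex abelian variety `A` by the adelic point `[J, a]`
(★ `SiegelAdelicMarking`: a uniformisation `A(ℂ) ≅ (V_ℝ, J)/Λ_a`, `V = ℚ^{2g}`, `Λ_a = V ∩ a ẑ^{2g}`, with torsion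
parametrisation `u = m.r : V → A(ℂ)`, `ker u = Λ_a`) and `N ≠ 0`, the points
`xᵢ := u(vᵢ)`, where `a⁻¹ v̂ᵢ ≡ eᵢ/N (mod ẑ^{2g})`, form a BASIS of `A[N](ℂ) ≅ (ℤ/N)^{2g}` — this is
[Milne2005ShimuraVarieties] (63) «`η = u ∘ a`» read on `N`-division points ([Deligne1971TravauxShimura] 4.12 (b),
4.16) — hence ([MumfordFogartyKirwan1994] Ch. 7 §2 Def. 7.1, the tree's ★ `LevelStructure.exists_of_torsionBasis`)
a LEVEL-`N` STRUCTURE on the abelian scheme `ofAbelianVariety A → Spec ℂ` whose basis sections are the `xᵢ`.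

* `adelicCongr_sum_nsmul` — readings are additive over finite `ℕ`-linear combinations;
* `r_sum_nsmul` — `u(∑ nᵢ vᵢ) = ∏ u(vᵢ)^{nᵢ}`;
* `sum_val_smul_singleValDiv_eq` — `∑ᵢ c̃ᵢ • (eᵢ/N)~ = c̃/N` (the class arithmetic of the standard basis);
* `r_reading_pow_eq_one`, `readings_injective` — the `xᵢ` are `N`-torsion and `ℤ/N`-independent;
* **`exists_levelStructure_reading`** — THE HEAD: `∃ φ : LevelStructure g N (ofAbelianVariety A)`,
  `∀ i, ∃ v, a⁻¹ v̂ ≡ eᵢ/N ∧ (φ.σ i).left = (u v).left` (the text of the cell's (U)-head socket `UaSigma_ofMarking`,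
  = the `hlevel` binder of ★ `SiegelAdelicMarking.exists_symplecticLift_of_levelReading`).

## References
* [Milne2005ShimuraVarieties] J. S. Milne, *Introduction to Shimura varieties* (2005), §6 Thm. 6.11 p. 74 and p. 75,
  §12 (63) p. 116.
* [Deligne1971TravauxShimura] P. Deligne, *Travaux de Shimura*, Sém. Bourbaki 389 (1971), 4.12 (b) pp. 148–149,
  4.16 p. 150.
* [MumfordFogartyKirwan1994] D. Mumford, J. Fogarty, F. Kirwan, *Geometric Invariant Theory*, 3rd ed. (1994),
  Ch. 7 §2 Definition 7.1 (p. 129).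
-/

set_option autoImplicit false

noncomputable section

open Matrix CategoryTheory AlgebraicGeometry
open Literature.AlgebraicGeometry.Motives (AbelianVariety AlgPoints CartierDivisor)
open Literature.AlgebraicGeometry.AbelianSchemes (AbelianSchemeOver)
open Literature.NumberTheory.Adeles (latticeOfGL mem_latticeOfGL_one_iff)

namespace Literature.AlgebraicGeometry.ModuliOfAbelianVarieties

variable {g : ℕ} {δ : Fin g → ℕ}

/-! ### §1 Readings and `u` on finite `ℕ`-linear combinations -/

section Sums

variable {b b' : GL (Fin g ⊕ Fin g) finAdeleQ}

/-- **Readings are additive over finite `ℕ`-linear combinations**: `b v̂ᵢ ≡ b′ ĉᵢ` for all `i ∈ s` implies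
`b (∑ nᵢ vᵢ)^ ≡ b′ (∑ nᵢ cᵢ)^`. [cite: Milne2005ShimuraVarieties, §6 Thm. 6.11 p. 74 and p. 75] -/
theorem adelicCongr_sum_nsmul {ι : Type*} (s : Finset ι) (n : ι → ℕ) (v c : ι → Fin g ⊕ Fin g → ℚ)
    (h : ∀ i ∈ s, AdelicCongr b b' (v i) (c i)) :
    AdelicCongr b b' (∑ i ∈ s, n i • v i) (∑ i ∈ s, n i • c i) := by
  classical
  induction s using Finset.induction_on with
  | empty => rw [Finset.sum_empty, Finset.sum_empty]; exact AdelicCongr.zero b b'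
  | insert j s hj ih =>
    rw [Finset.sum_insert hj, Finset.sum_insert hj]
    exact ((h j (Finset.mem_insert_self j s)).nsmul (n j)).add
      (ih fun i hi => h i (Finset.mem_insert_of_mem hi))

end Sums

namespace SiegelAdelicMarking

variable {J : C0pm δ} {a : gspFinAdelic δ} {A : AbelianVariety ℂ} (m : SiegelAdelicMarking J a A)

/-- **`u(∑ nᵢ vᵢ) = ∏ u(vᵢ)^{nᵢ}`** (`u = m.r` is additive, ★ `r_add`/`r_nsmul`/`r_zero`).
[cite: Milne2005ShimuraVarieties, §6 Thm. 6.11 p. 74] -/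
theorem r_sum_nsmul {ι : Type*} (s : Finset ι) (n : ι → ℕ) (v : ι → Fin g ⊕ Fin g → ℚ) :
    m.r (∑ i ∈ s, n i • v i) = ∏ i ∈ s, m.r (v i) ^ n i := by
  classical
  induction s using Finset.induction_on with
  | empty => rw [Finset.sum_empty, Finset.prod_empty]; exact m.r_zero
  | insert j s hj ih => rw [Finset.sum_insert hj, Finset.prod_insert hj, m.r_add, m.r_nsmul, ih]

/-! ### §2 The class arithmetic of the standard basis `eᵢ/N` -/

/-- **`∑ᵢ c̃ᵢ • (eᵢ/N)~ = c̃/N`** for `c ∈ (ℤ/N)^{2g}`, where `x̃ := (x j).val` are the standard lifts: the `j`-th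
coordinate of the left side is `c̃ⱼ · 1̃/N`, and `1̃ = 1` unless `N = 1`, where `c̃ⱼ = 0`.
[cite: Milne2005ShimuraVarieties, §6 p. 75] -/
theorem sum_val_smul_singleValDiv_eq (N : ℕ) (c : Fin g ⊕ Fin g → ZMod N) :
    (∑ i : Fin g ⊕ Fin g, (c i).val •
        fun j => (((Pi.single i (1 : ZMod N) : Fin g ⊕ Fin g → ZMod N) j).val : ℚ) / N) =
      fun j => ((c j).val : ℚ) / N := by
  funext j
  rw [Finset.sum_apply, Finset.sum_eq_single j]
  · simp only [Pi.smul_apply, Pi.single_eq_same, nsmul_eq_mul]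
    rcases Nat.lt_or_ge 1 N with hN | hN
    · haveI : Fact (1 < N) := ⟨hN⟩
      rw [ZMod.val_one, Nat.cast_one, one_div, div_eq_mul_inv]
    · interval_cases N
      · simp
      · have : (c j).val = 0 := Nat.lt_one_iff.mp (ZMod.val_lt (c j))
        simp [this]
  · intro i _ hij
    simp only [Pi.smul_apply, Pi.single_eq_of_ne (Ne.symm hij), ZMod.val_zero, Nat.cast_zero, zero_div,
      smul_zero]
  · intro h; exact absurd (Finset.mem_univ j) h

/-! ### §3 The `N`-division readings are `N`-torsion and `ℤ/N`-independent -/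

section Readings

variable {N : ℕ} {v : Fin g ⊕ Fin g → Fin g ⊕ Fin g → ℚ}

/-- **`xᵢ = u(vᵢ)` is `N`-torsion** when `a⁻¹ v̂ᵢ ≡ eᵢ/N` (★ `r_mem_torsionPoints_of_adelicCongr_one`, since
`N · (eᵢ/N)~ ∈ ℤ^{2g}`). [cite: Milne2005ShimuraVarieties, §6 Thm. 6.11 p. 74 and §12 (63) p. 116] -/
theorem r_reading_pow_eq_one
    (hv : ∀ i, AdelicCongr ((a⁻¹ : gspFinAdelic δ) : GL (Fin g ⊕ Fin g) finAdeleQ) 1 (v i)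
      (fun j => (((Pi.single i (1 : ZMod N) : Fin g ⊕ Fin g → ZMod N) j).val : ℚ) / N))
    (i : Fin g ⊕ Fin g) : m.r (v i) ^ N = 1 := by
  have h := m.r_mem_torsionPoints_of_adelicCongr_one (hv i)
    (nsmul_valDiv_mem_latticeOfGL_one N (Pi.single i (1 : ZMod N)))
  rwa [AbelianVariety.mem_torsionPoints_iff, zpow_natCast] at h

/-- **The readings `∑ c̃ᵢ vᵢ` of the combinations read the classes `c̃/N`**: `a⁻¹ (∑ c̃ᵢ v̂ᵢ) ≡ c̃/N`.
[cite: Milne2005ShimuraVarieties, §6 Thm. 6.11 p. 74 and p. 75] -/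
theorem adelicCongr_sum_val_smul
    (hv : ∀ i, AdelicCongr ((a⁻¹ : gspFinAdelic δ) : GL (Fin g ⊕ Fin g) finAdeleQ) 1 (v i)
      (fun j => (((Pi.single i (1 : ZMod N) : Fin g ⊕ Fin g → ZMod N) j).val : ℚ) / N))
    (c : Fin g ⊕ Fin g → ZMod N) :
    AdelicCongr ((a⁻¹ : gspFinAdelic δ) : GL (Fin g ⊕ Fin g) finAdeleQ) 1 (∑ i, (c i).val • v i)
      (fun j => ((c j).val : ℚ) / N) := by
  rw [← sum_val_smul_singleValDiv_eq N c]
  exact adelicCongr_sum_nsmul Finset.univ (fun i => (c i).val) v _ fun i _ => hv i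

/-- **`ℤ/N`-independence of the `xᵢ = u(vᵢ)`** (`N ≠ 0`): `c ↦ ∏ᵢ x(inl i)^{c̃(inl i)} · ∏ᵢ x(inr i)^{c̃(inr i)}` is
injective on `(ℤ/N)^{2g}` — the product is `u(∑ c̃ᵢ vᵢ)`, which reads the class `c̃/N`, and a torsion point has ONE
reading class (★ `readingClass_eq_of_r_eq`). [cite: Milne2005ShimuraVarieties, §6 Thm. 6.11 p. 74 and §12 (63) p. 116]
[cite: Deligne1971TravauxShimura, 4.12 (b) pp. 148–149] -/
theorem readings_injective (hN : N ≠ 0)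
    (hv : ∀ i, AdelicCongr ((a⁻¹ : gspFinAdelic δ) : GL (Fin g ⊕ Fin g) finAdeleQ) 1 (v i)
      (fun j => (((Pi.single i (1 : ZMod N) : Fin g ⊕ Fin g → ZMod N) j).val : ℚ) / N)) :
    Function.Injective fun c : Fin g ⊕ Fin g → ZMod N =>
      (List.ofFn fun i : Fin g => m.r (v (Sum.inl i)) ^ (c (Sum.inl i)).val).prod *
        (List.ofFn fun i : Fin g => m.r (v (Sum.inr i)) ^ (c (Sum.inr i)).val).prod := by
  have key : ∀ c : Fin g ⊕ Fin g → ZMod N,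
      (List.ofFn fun i : Fin g => m.r (v (Sum.inl i)) ^ (c (Sum.inl i)).val).prod *
          (List.ofFn fun i : Fin g => m.r (v (Sum.inr i)) ^ (c (Sum.inr i)).val).prod =
        m.r (∑ i, (c i).val • v i) := fun c => by
    rw [m.r_sum_nsmul, Fintype.prod_sum_type, List.prod_ofFn, List.prod_ofFn]
  intro c c' h
  have h' : m.r (∑ i, (c i).val • v i) = m.r (∑ i, (c' i).val • v i) := by
    rw [← key c, ← key c']; exact h
  exact m.readingClass_eq_of_r_eq hN (adelicCongr_sum_val_smul hv c) (adelicCongr_sum_val_smul hv c') h'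

end Readings

/-! ### §4 The level structure of a marking -/

/-- **THE LEVEL-`N` STRUCTURE OF A MARKED COMPLEX ABELIAN VARIETY** ([Milne2005ShimuraVarieties] (63) `η_a = u ∘ a`;
[MumfordFogartyKirwan1994] Def. 7.1): for a marking `m` of `A` by `[J, a]` and `N ≠ 0` there is a level-`N` structure
`φ` on `ofAbelianVariety A → Spec ℂ` whose basis sections are the `N`-division readings of the marking: for every `i`
there is `v` with `a⁻¹ v̂ ≡ eᵢ/N (mod ẑ^{2g})` and `(φ.σ i).left = (u v).left`.  Proof: choose readings `vᵢ` of
`eᵢ/N` (★ `exists_adelicCongr_inv_one`); the points `u(vᵢ)` are `N`-torsion (`r_reading_pow_eq_one`) and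
`ℤ/N`-independent (`readings_injective`), so ★ `LevelStructure.exists_of_torsionBasis` (with ★ `dim_eq`) applies.
This is the text of the cell's (U)-head socket `UaSigma_ofMarking` and the `hlevel` binder of ★
`exists_symplecticLift_of_levelReading`. [cite: Milne2005ShimuraVarieties, §6 Thm. 6.11 p. 74 and §12 (63) p. 116]
[cite: MumfordFogartyKirwan1994, Ch. 7 §2 Definition 7.1 (p. 129)] [cite: Deligne1971TravauxShimura, 4.12 (b) pp. 148–149 and 4.16 p. 150] -/
theorem exists_levelStructure_reading {N : ℕ} (hN : N ≠ 0) :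
    ∃ φ : (AbelianSchemeOver.ofAbelianVariety A).LevelStructure g N,
      ∀ i : Fin g ⊕ Fin g, ∃ v : Fin g ⊕ Fin g → ℚ,
        AdelicCongr ((a⁻¹ : gspFinAdelic δ) : GL (Fin g ⊕ Fin g) finAdeleQ) 1 v
            (fun j => (((Pi.single i (1 : ZMod N) : Fin g ⊕ Fin g → ZMod N) j).val : ℚ) / N) ∧
          @Eq (Spec (.of ℂ) ⟶ A.X.left) (φ.σ i).left (m.r v).left := by
  have hex : ∀ i : Fin g ⊕ Fin g, ∃ v : Fin g ⊕ Fin g → ℚ,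
      AdelicCongr ((a⁻¹ : gspFinAdelic δ) : GL (Fin g ⊕ Fin g) finAdeleQ) 1 v
        (fun j => (((Pi.single i (1 : ZMod N) : Fin g ⊕ Fin g → ZMod N) j).val : ℚ) / N) :=
    fun i => exists_adelicCongr_inv_one (a := a) _
  choose v hv using hex
  have hN' : (N : ℂ) ≠ 0 := Nat.cast_ne_zero.2 hN
  obtain ⟨φ, hφ⟩ := AbelianSchemeOver.LevelStructure.exists_of_torsionBasis A m.dim_eq hN' (fun i => m.r (v i))
    (m.r_reading_pow_eq_one hv) (m.readings_injective hN hv)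
  exact ⟨φ, fun i => ⟨v i, hv i, hφ i⟩⟩

end SiegelAdelicMarking

end Literature.AlgebraicGeometry.ModuliOfAbelianVarieties

end
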